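import Literature.Geometry.Lorentzian.ConvergenceTransport
import HarnessLib

/-!
# Timecones: the convex-cone algebra of future-directed causal vectors

Pointwise linear algebra of a time-oriented Lorentzian metric `(g, τ)` at a point `x` of a
manifold `M`: O'Neill's facts on timecones (O'Neill 1983, Ch. 5, Lemma 5.26, Cor. 5.27,
Lemma 5.29, Prop. 5.30, pp. 141–144), proved from the two signature axioms of
`Literature.Geometry.Lorentzian.LorentzianMetric` (`τ_x` is timelike; `g_x` is positive definite
on the `g_x`-orthogonal complement of a timelike vector):

* `TimeOrientation.nonneg_of_orthogonal`, `sq_le_mul_of_orthogonal` — `τ_x^⊥` is spacelike and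
  satisfies the Cauchy–Schwarz inequality (Lemma 5.26);
* `TimeOrientation.mul_le_sq` — the reverse Cauchy–Schwarz inequality
  `g(τ,τ) g(v,v) ≤ g(τ,v)²` (Prop. 5.30 (1), here with the orienting vector as the timelike one);
* `TimeOrientation.IsFutureDirected.val_nonpos` — two future-directed causal vectors `v`, `w`
  have `g(v,w) ≤ 0` (p. 144, causal cones; the strict version for `v` timelike is
  `TimeOrientation.IsFutureDirected.val_lt_zero` of
  `Literature.Geometry.Lorentzian.ConvergenceTransport`, Lemma 5.29);
* `TimeOrientation.IsFutureDirected.add`, `isTimelike_add_left/right` — the future causal cone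
  and the future timecone are convex cones (Lemma 5.29: "`av + bw ∈ C(u)` for `a, b ≥ 0` not
  both zero"); positive rescaling (`IsTimelike.smul`, `IsFutureDirected.smul`) is already in
  `Literature.Geometry.Lorentzian.CausalityProofs`;
* `TimeOrientation.isFutureDirected_iff_val_neg` — any future timelike vector orients the same
  cone as `τ_x`;
* `TimeOrientation.isOpen_setOf_isTimelike_and_isFutureDirected` — the future timecone at a
  point is open in the tangent space.

These are the pointwise tools for the causality theory of
`Literature.Geometry.Lorentzian.Causality` (corner smoothing, push-up of causal curves). No
definition is introduced.

## References

* B. O'Neill, *Semi-Riemannian geometry with applications to relativity*, Academic Press 1983,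
  Ch. 5, pp. 141–145: Lemma 5.26 (`z^⊥` spacelike), Cor. 5.27, Lemma 5.29 (timecones),
  Prop. 5.30 (reverse Cauchy–Schwarz), Lemma 5.32 (time orientation by a timelike field).
-/

noncomputable section

open Set Filter
open scoped Topology Manifold ContDiff

namespace Literature.Geometry.Lorentzian

variable {E : Type*} [NormedAddCommGroup E] [NormedSpace ℝ E] {H : Type*} [TopologicalSpace H]
  {I : ModelWithCorners ℝ E H} {n : ℕ∞ω} {M : Type*} [TopologicalSpace M] [ChartedSpace H M]
  [IsManifold I ∞ M]

namespace TimeOrientation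

variable {g : LorentzianMetric I n M} (τ : TimeOrientation g) {x : M}

/-! ### The orthogonal complement of the orienting vector is an inner product space -/

/-- On `τ_x^⊥` the metric is nonnegative. O'Neill 1983, Ch. 5, Lemma 5.26. [cite: ONeillSemiRiemannian1983, Ch. 5, Lemma 5.26 (p. 141)] -/
lemma nonneg_of_orthogonal {u : TangentSpace I x} (hu : g.val x (τ.vectorField x) u = 0) :
    0 ≤ g.val x u u := by
  by_cases hu0 : u = 0
  · rw [hu0, map_zero]
  · exact (g.pos_of_orthogonal x _ u (τ.isTimelike x) hu hu0).le

/-- **Cauchy–Schwarz on `τ_x^⊥`**: for `u, u' ⊥ τ_x`, `g(u,u')² ≤ g(u,u) g(u',u')` (the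
orthogonal complement is an inner product space). O'Neill 1983, Ch. 5, Lemma 5.26. [cite: ONeillSemiRiemannian1983, Ch. 5, Lemma 5.26 (p. 141)] -/
lemma sq_le_mul_of_orthogonal {u u' : TangentSpace I x} (hu : g.val x (τ.vectorField x) u = 0)
    (hu' : g.val x (τ.vectorField x) u' = 0) :
    (g.val x u u') ^ 2 ≤ g.val x u u * g.val x u' u' := by
  have hq : ∀ t : ℝ, 0 ≤ g.val x u' u' * (t * t) + 2 * g.val x u u' * t + g.val x u u := by
    intro t
    have horth : g.val x (τ.vectorField x) (u + t • u') = 0 := by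
      simp [map_add, map_smul, hu, hu']
    have h0 := τ.nonneg_of_orthogonal horth
    have hsym : g.val x u' u = g.val x u u' := g.symm x u' u
    have hexp : g.val x (u + t • u') (u + t • u') =
        g.val x u' u' * (t * t) + 2 * g.val x u u' * t + g.val x u u := by
      simp only [map_add, map_smul, smul_eq_mul, add_apply, FunLike.coe_smul, Pi.smul_apply, hsym]
      ring
    exact hexp ▸ h0
  have hd := discrim_le_zero hq
  rw [discrim] at hd
  nlinarith [hd]

/-- The vector `g(τ,τ) • v - g(τ,v) • τ` is orthogonal to `τ` (projection to `τ^⊥`, cleared of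
denominators). O'Neill 1983, Ch. 5, proof of Prop. 5.30 ("write `w = av + w⃗` with
`w⃗ ∈ v^⊥`"). [cite: ONeillSemiRiemannian1983, Ch. 5, Prop. 5.30 (proof, p. 144)] -/
lemma orthogonal_proj (v : TangentSpace I x) :
    g.val x (τ.vectorField x)
      (g.val x (τ.vectorField x) (τ.vectorField x) • v -
        g.val x (τ.vectorField x) v • τ.vectorField x) = 0 := by
  simp only [map_sub, map_smul, smul_eq_mul]; ring

/-- The square of the projection: `g(v',v') = g(τ,τ) (g(τ,τ) g(v,v) − g(τ,v)²)` for
`v' = g(τ,τ) • v − g(τ,v) • τ`. O'Neill 1983, Ch. 5, proof of Prop. 5.30. [cite: ONeillSemiRiemannian1983, Ch. 5, Prop. 5.30 (proof, p. 144)] -/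
lemma proj_sq (v : TangentSpace I x) :
    g.val x
        (g.val x (τ.vectorField x) (τ.vectorField x) • v -
          g.val x (τ.vectorField x) v • τ.vectorField x)
        (g.val x (τ.vectorField x) (τ.vectorField x) • v -
          g.val x (τ.vectorField x) v • τ.vectorField x) =
      g.val x (τ.vectorField x) (τ.vectorField x) *
        (g.val x (τ.vectorField x) (τ.vectorField x) * g.val x v v -
          g.val x (τ.vectorField x) v ^ 2) := by
  have h1 : g.val x v (τ.vectorField x) = g.val x (τ.vectorField x) v := g.symm x v _
  simp only [map_sub, map_smul, smul_eq_mul, sub_apply, FunLike.coe_smul, Pi.smul_apply, h1]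
  ring

/-- The product of two projections: `g(v',w') = g(τ,τ) (g(τ,τ) g(v,w) − g(τ,v) g(τ,w))`.
O'Neill 1983, Ch. 5, proof of Lemma 5.29. [cite: ONeillSemiRiemannian1983, Ch. 5, Lemma 5.29 (proof, p. 143)] -/
lemma proj_inner (v w : TangentSpace I x) :
    g.val x
        (g.val x (τ.vectorField x) (τ.vectorField x) • v -
          g.val x (τ.vectorField x) v • τ.vectorField x)
        (g.val x (τ.vectorField x) (τ.vectorField x) • w -
          g.val x (τ.vectorField x) w • τ.vectorField x) =
      g.val x (τ.vectorField x) (τ.vectorField x) *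
        (g.val x (τ.vectorField x) (τ.vectorField x) * g.val x v w -
          g.val x (τ.vectorField x) v * g.val x (τ.vectorField x) w) := by
  have h1 : g.val x v (τ.vectorField x) = g.val x (τ.vectorField x) v := g.symm x v _
  simp only [map_sub, map_smul, smul_eq_mul, sub_apply, FunLike.coe_smul, Pi.smul_apply, h1]
  ring

/-- **Reverse Cauchy–Schwarz inequality** for the orienting vector: `g(τ,τ) g(v,v) ≤ g(τ,v)²`
for every `v`. O'Neill 1983, Ch. 5, Prop. 5.30 (1). [cite: ONeillSemiRiemannian1983, Ch. 5, Prop. 5.30 (1) (p. 144)] -/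
theorem mul_le_sq (v : TangentSpace I x) :
    g.val x (τ.vectorField x) (τ.vectorField x) * g.val x v v ≤
      g.val x (τ.vectorField x) v ^ 2 := by
  have h0 := τ.nonneg_of_orthogonal (τ.orthogonal_proj v)
  rw [τ.proj_sq] at h0
  have hT : g.val x (τ.vectorField x) (τ.vectorField x) < 0 := τ.isTimelike x
  nlinarith [hT, h0]

/-- The key inequality behind the sign of scalar products of causal vectors:
`(g(τ,τ) g(v,w) − g(τ,v) g(τ,w))² ≤ (g(τ,v)² − g(τ,τ) g(v,v)) (g(τ,w)² − g(τ,τ) g(w,w))`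
(Cauchy–Schwarz for the projections of `v`, `w` to `τ^⊥`). O'Neill 1983, Ch. 5, proof of
Lemma 5.29. [cite: ONeillSemiRiemannian1983, Ch. 5, Lemma 5.29 (proof, p. 143)] -/
lemma sq_proj_inner_le (v w : TangentSpace I x) :
    (g.val x (τ.vectorField x) (τ.vectorField x) * g.val x v w -
        g.val x (τ.vectorField x) v * g.val x (τ.vectorField x) w) ^ 2 ≤
      (g.val x (τ.vectorField x) v ^ 2 - g.val x (τ.vectorField x) (τ.vectorField x) * g.val x v v) *
        (g.val x (τ.vectorField x) w ^ 2 -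
          g.val x (τ.vectorField x) (τ.vectorField x) * g.val x w w) := by
  have hcs := τ.sq_le_mul_of_orthogonal (τ.orthogonal_proj v) (τ.orthogonal_proj w)
  rw [τ.proj_inner, τ.proj_sq, τ.proj_sq] at hcs
  have hT : g.val x (τ.vectorField x) (τ.vectorField x) < 0 := τ.isTimelike x
  have hT2 : 0 < g.val x (τ.vectorField x) (τ.vectorField x) ^ 2 := by nlinarith
  have : (g.val x (τ.vectorField x) (τ.vectorField x) * g.val x v w -
        g.val x (τ.vectorField x) v * g.val x (τ.vectorField x) w) ^ 2 *
          g.val x (τ.vectorField x) (τ.vectorField x) ^ 2 ≤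
      (g.val x (τ.vectorField x) v ^ 2 -
            g.val x (τ.vectorField x) (τ.vectorField x) * g.val x v v) *
          (g.val x (τ.vectorField x) w ^ 2 -
            g.val x (τ.vectorField x) (τ.vectorField x) * g.val x w w) *
        g.val x (τ.vectorField x) (τ.vectorField x) ^ 2 := by
    nlinarith [hcs]
  exact le_of_mul_le_mul_right this hT2

/-! ### Scalar products of future-directed vectors -/

/-- **Future-directed causal vectors pair nonpositively**: `g(v, w) ≤ 0`. O'Neill 1983, Ch. 5,
Lemma 5.29 and p. 144 (causal cones). [cite: ONeillSemiRiemannian1983, Ch. 5, Lemma 5.29 (p. 143)] -/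
theorem IsFutureDirected.val_nonpos {v w : TangentSpace I x} (hv : τ.IsFutureDirected v)
    (hw : τ.IsFutureDirected w) : g.val x v w ≤ 0 := by
  have hT : g.val x (τ.vectorField x) (τ.vectorField x) < 0 := τ.isTimelike x
  have hkey := τ.sq_proj_inner_le v w
  have hvv : g.val x v v ≤ 0 := hv.1.1
  have hww : g.val x w w ≤ 0 := hw.1.1
  have hTv : g.val x (τ.vectorField x) v < 0 := hv.2
  have hTw : g.val x (τ.vectorField x) w < 0 := hw.2
  have hpv : 0 ≤ g.val x (τ.vectorField x) (τ.vectorField x) * g.val x v v :=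
    mul_nonneg_of_nonpos_of_nonpos hT.le hvv
  have hpw : 0 ≤ g.val x (τ.vectorField x) (τ.vectorField x) * g.val x w w :=
    mul_nonneg_of_nonpos_of_nonpos hT.le hww
  have h1 := τ.mul_le_sq v
  have h2 := τ.mul_le_sq w
  set a := g.val x (τ.vectorField x) v
  set c := g.val x (τ.vectorField x) w
  set β := g.val x (τ.vectorField x) (τ.vectorField x)
  have hX : (β * g.val x v w - a * c) ^ 2 ≤ (a * c) ^ 2 := by
    calc (β * g.val x v w - a * c) ^ 2
        ≤ (a ^ 2 - β * g.val x v v) * (c ^ 2 - β * g.val x w w) := hkey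
      _ ≤ a ^ 2 * c ^ 2 := by
          apply mul_le_mul (by linarith) (by linarith) (by linarith) (sq_nonneg _)
      _ = (a * c) ^ 2 := by ring
  have hpos : 0 < a * c := mul_pos_of_neg_of_neg hTv hTw
  have hge : 0 ≤ β * g.val x v w := by
    by_contra hcon
    push Not at hcon
    nlinarith [hX, hpos, hcon]
  by_contra hcon
  push Not at hcon
  nlinarith [mul_neg_of_neg_of_pos hT hcon]

/-- A future-directed timelike vector `v` orients the same cones as `τ_x`: a causal vector `w`
is future-directed iff `g(v, w) < 0`. O'Neill 1983, Ch. 5, Lemma 5.29 (timecones are well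
defined) and Lemma 5.32. [cite: ONeillSemiRiemannian1983, Ch. 5, Lemma 5.29 (p. 143)] -/
theorem isFutureDirected_iff_val_neg {v w : TangentSpace I x} (hv : τ.IsFutureDirected v)
    (hvt : g.IsTimelike v) (hw : g.IsCausal w) : τ.IsFutureDirected w ↔ g.val x v w < 0 :=
  ⟨fun h ↦ hv.val_lt_zero τ hvt h, fun h ↦ τ.isFutureDirected_of_val_lt_zero hv hvt hw h⟩

/-! ### The future cones are convex cones -/

/-- **Sum of future-directed causal vectors is future-directed causal.** O'Neill 1983, Ch. 5,
Lemma 5.29 and p. 144. [cite: ONeillSemiRiemannian1983, Ch. 5, Lemma 5.29 (p. 143)] -/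
theorem IsFutureDirected.add {v w : TangentSpace I x} (hv : τ.IsFutureDirected v)
    (hw : τ.IsFutureDirected w) : τ.IsFutureDirected (v + w) := by
  have hvw := hv.val_nonpos τ hw
  have hwv : g.val x w v = g.val x v w := g.symm x w v
  have hvv : g.val x v v ≤ 0 := hv.1.1
  have hww : g.val x w w ≤ 0 := hw.1.1
  have hTv := hv.2
  have hTw := hw.2
  have hT : g.val x (τ.vectorField x) (v + w) < 0 := by rw [map_add]; linarith
  refine ⟨⟨?_, fun h0 ↦ ?_⟩, hT⟩
  · simp only [map_add, add_apply, hwv]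
    linarith
  · rw [h0, map_zero] at hT
    exact lt_irrefl _ hT

/-- **A future timelike vector plus a future causal vector is (future) timelike.**
O'Neill 1983, Ch. 5, Lemma 5.29. [cite: ONeillSemiRiemannian1983, Ch. 5, Lemma 5.29 (p. 143)] -/
theorem IsFutureDirected.isTimelike_add_left {v w : TangentSpace I x}
    (hv : τ.IsFutureDirected v) (hvt : g.IsTimelike v) (hw : τ.IsFutureDirected w) :
    g.IsTimelike (v + w) := by
  have hvw := hv.val_lt_zero τ hvt hw
  have hwv : g.val x w v = g.val x v w := g.symm x w v
  have hvv : g.val x v v < 0 := hvt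
  have hww : g.val x w w ≤ 0 := hw.1.1
  show g.val x (v + w) (v + w) < 0
  simp only [map_add, add_apply, hwv]
  linarith

/-- **A future causal vector plus a future timelike vector is (future) timelike.**
O'Neill 1983, Ch. 5, Lemma 5.29. [cite: ONeillSemiRiemannian1983, Ch. 5, Lemma 5.29 (p. 143)] -/
theorem IsFutureDirected.isTimelike_add_right {v w : TangentSpace I x}
    (hv : τ.IsFutureDirected v) (hw : τ.IsFutureDirected w) (hwt : g.IsTimelike w) :
    g.IsTimelike (v + w) := by
  rw [add_comm]
  exact hw.isTimelike_add_left τ hwt hv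

/-- Finite sums: a sum of future-directed causal vectors indexed by a nonempty finset is
future-directed causal. O'Neill 1983, Ch. 5, Lemma 5.29. [cite: ONeillSemiRiemannian1983, Ch. 5, Lemma 5.29 (p. 143)] -/
theorem isFutureDirected_sum {ι : Type*} {s : Finset ι} (hs : s.Nonempty)
    {v : ι → TangentSpace I x} (hv : ∀ i ∈ s, τ.IsFutureDirected (v i)) :
    τ.IsFutureDirected (∑ i ∈ s, v i) := by
  classical
  induction s using Finset.induction_on with
  | empty => exact absurd hs Finset.not_nonempty_empty
  | insert a s ha ih =>
    rw [Finset.sum_insert ha]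
    rcases s.eq_empty_or_nonempty with hse | hsne
    · subst hse
      simpa using hv a (Finset.mem_insert_self a _)
    · exact (hv a (Finset.mem_insert_self a _)).add τ
        (ih hsne fun i hi ↦ hv i (Finset.mem_insert_of_mem hi))

/-! ### The future timecone is open -/

/-- **The future timecone at a point is open** in the tangent space. O'Neill 1983, Ch. 5,
Lemma 5.29 ff. (timecones are open convex cones). [cite: ONeillSemiRiemannian1983, Ch. 5, Lemma 5.29 (p. 143)] -/
theorem isOpen_setOf_isTimelike_and_isFutureDirected (x : M) :
    IsOpen {v : TangentSpace I x | g.IsTimelike v ∧ τ.IsFutureDirected v} := by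
  letI : NormedAddCommGroup (TangentSpace I x) := inferInstanceAs (NormedAddCommGroup E)
  letI : NormedSpace ℝ (TangentSpace I x) := inferInstanceAs (NormedSpace ℝ E)
  have h1 : Continuous fun v : TangentSpace I x ↦ g.val x v v :=
    (g.val x).continuous₂.comp (continuous_id.prodMk continuous_id)
  have h2 : Continuous fun v : TangentSpace I x ↦ g.val x (τ.vectorField x) v :=
    (g.val x (τ.vectorField x)).continuous
  have : {v : TangentSpace I x | g.IsTimelike v ∧ τ.IsFutureDirected v} =
      {v | g.val x v v < 0} ∩ {v | g.val x (τ.vectorField x) v < 0} := by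
    ext v
    simp only [mem_setOf_eq, mem_inter_iff]
    exact ⟨fun h ↦ ⟨h.1, h.2.2⟩, fun h ↦ ⟨h.1, LorentzianMetric.IsTimelike.isCausal g h.1, h.2⟩⟩
  rw [this]
  exact (isOpen_lt h1 continuous_const).inter (isOpen_lt h2 continuous_const)

/-- Openness in use: if `v` is future timelike at `x` then so is every vector close to `v`.
O'Neill 1983, Ch. 5, Lemma 5.29 ff. [cite: ONeillSemiRiemannian1983, Ch. 5, Lemma 5.29 (p. 143)] -/
theorem eventually_isTimelike_and_isFutureDirected {v : TangentSpace I x} (hvt : g.IsTimelike v)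
    (hv : τ.IsFutureDirected v) :
    ∀ᶠ w in 𝓝 v, g.IsTimelike w ∧ τ.IsFutureDirected w :=
  (τ.isOpen_setOf_isTimelike_and_isFutureDirected x).mem_nhds ⟨hvt, hv⟩

end TimeOrientation

end Literature.Geometry.Lorentzian

end
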